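import Summits.BirchSwinnertonDyer.BirchSwinnertonDyer.Theorems.SylvesterTwoHeegnerIndexCMDataGeomPackage
import Literature.NumberTheory.EllipticCurves.RingClassGalOverCyclicProofs
import HarnessLib

/-!
# DATA LAYER (R-d) of leaf (L1), crux `UpperOffV0HSYPlus` (stmt-BirchSwinnertonDyer-19804): the recipe
# R0 `HuShuYin2019.exists_cmFrame_kolyvaginClass` CALLED END-TO-END at one Kolyvagin prime — the
# recipe-shape witnesses of #24's per-`ℓ` block EXIST (level `9pℓ`, `M = 1`)

Skeleton of record VARIANT M (`Cruxes/UpperOffV0HSYPlus/Lines/coupled_variantM.lean` 406ca288e244d392); card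
v24/v25: `(L1)[δY₁] ⟸ L1_of_cmFrameClasses_four … ⟨cA, cB, hA, hB⟩` (#24 p654717), whose per-`ℓ` block asks
for classes IN RECIPE SHAPE (`ιK, emb, N, v, ψ, A, hdiv, hA, Q ∈ E₉(K̄)^N, hQ'`) plus the AT-LEVEL FLIP iff
(research).  Here the witnesses are PRODUCED from the route binders `(K, ω, [K:ℚ] = 2)`, a model `W` of `E_9`
with `Dt : ModularParametrizationData W 243`, a `Γ_K`-equivariant `κ : E₉(K̄) ≃+ W(K̄)` and `2 ∣ a_ℓ(W)` (both
DISCHARGED for `W₀ = ⟨0,0,1,0,−1⟩`), primes `p ≡ 1 (3)`, `ℓ ≡ 2 (3)`, `ℓ ≠ 2`; the point fed to R0 is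
`P = κ⁻¹ ι_emb(D_ℓ y_ℓ)` (#R-a rationality, #R-b Gross 3.6, #R-c `K̄` package).
* `exists_map_eq_phi_sylvesterTau_one_nine_mul` — the bottom point as a point of `E(K[9pℓ])` ((ES1)'s `y₀`);
* `exists_recipeShape_sylvester_prime` — the end-to-end call for any twist parameter `c` with a cube root
  in `K[9p]` (`b = 9c`), with Gross 4.7 (1)'s vanishing criterion; `exists_recipeShape_cubicTwist` (`b = p`,
  `3p²`); `exists_recipeShape_cubicTwist_sylvesterNineMinimal` (`κ`, `2 ∣ a_ℓ` discharged for `W₀`);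
* `exists_recipeBlock_three_mul_sq` / `exists_recipeBlock_prime` — **#24's per-`ℓ` ∃-block VERBATIM minus the
  FLIP iff**, `(2 : ℕ)` literals, `∃ c ιK emb … hQ', c = kolyvaginClass … (ψ Q) hQ'` (planner D453 (i)).
NOT touched: the AT-LEVEL FLIP iffs, the two-prime level `9p(ℓℓ')` (classes `c_B(ℓℓ')`; sibling files
`…CMDataPairTrace/PairDerivative/PairRecipe`), the height display, BSD; no stub closed; theorems only;
`--supports stmt-BirchSwinnertonDyer-19804 --as helper`.

## References
* B. H. Gross, LMS LNS 153 (1991), §3–§4. [GrossLMS1991] · W. G. McCallum, same volume, §4. [McCallumLMS1991]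
* Y. Hu, J. Shu, H. Yin, Trans. AMS 372 (2019), arXiv 1708.05266 §2, §4.1. [HuShuYin2019]

## Mathlib / tree search
Tree: R0 (`CubicTwistKolyvaginClassesJZero`); #R-a/#R-b/#R-c; `RingClassGalOverCyclic.exists_zpowers_eq_ringClassGalOver_mul`;
`GeomPointsEmbeddingDescent`; `SylvesterNineMinimalModel`; `JZeroKolyvaginPrimes`.
`lean search 'exists_recipeShape|exists_recipeBlock'` → nothing before this file. presearch: n/a (assembly).
-/

set_option linter.dupNamespace false -- Summits modules are `Summit.<Summit>.<Problem>…` by design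

noncomputable section

open scoped Classical

namespace Summit.BirchSwinnertonDyer.BirchSwinnertonDyer.Theorems.SylvesterTwoCMData

open Complex UpperHalfPlane NumberField WeierstrassCurve
open Literature.NumberTheory.EllipticCurves Literature.NumberTheory.EllipticCurves.ModularForms
  Literature.NumberTheory.EllipticCurves.HuShuYin2019
  Literature.NumberTheory.QuadraticFields.BinaryQuadraticForm
  Literature.FieldTheory.AlgClosed

variable {K : Type} [Field K] [NumberField K]

/-- `√(m²D) = m√D` (re-proved; private in the sibling files). [folklore] -/
private theorem sqrtDisc_conductor_sq_mul' (D : ℤ) (m : ℕ) :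
    sqrtDisc ((m : ℤ) ^ 2 * D) = (m : ℂ) * sqrtDisc D := by
  unfold sqrtDisc
  have hm : (0 : ℝ) ≤ m := Nat.cast_nonneg m
  have h : -(((m : ℤ) ^ 2 * D : ℤ) : ℝ) = (m : ℝ) ^ 2 * (-(D : ℝ)) := by push_cast; ring
  rw [h, Real.sqrt_mul (sq_nonneg _), Real.sqrt_sq hm]
  push_cast
  ring

/-- **The bottom point `y₁` (conductor `9p`) as a point of `E(K[9pℓ])`** — the `y₀` of (ES1) at the level `9pℓ`
(`Aut(ℂ/K[9pℓ])` fixes `K[9p] ⊆ K[9pℓ]`, hence `9p·√d_K`, the level structure of `τ_{Q_p}` and `φ(τ_{Q_p})`;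
coordinate descent). [cite: GrossLMS1991, §3 (p. 238: y_m ∈ E(K_m) ⊂ E(K_n))] [cite: HuShuYin2019, §4.1 (p. 10 L92)] -/
theorem exists_map_eq_phi_sylvesterTau_one_nine_mul (hK : IsImaginaryQuadratic K)
    (hdK : NumberField.discr K = -3) (ι : K →+* ℂ) {W : WeierstrassCurve ℚ}
    (Dt : ModularParametrizationData W 243) {p ℓ : ℕ} (hp : p % 3 = 1) (hℓ0 : ℓ ≠ 0) :
    ∃ y₀ : (W.baseChange (ringClassField K ι (9 * p * ℓ))).toAffine.Point,
      Affine.Point.map (W' := W) (ringClassField K ι (9 * p * ℓ)).subtype.toRatAlgHom y₀ =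
        Dt.φ (heegnerTau (81 * ((p : ℤ) ^ 2 + 4 * p + 16), -(9 * (4 * (p : ℤ) ^ 2 + 17 * p + 72)),
          4 * (p : ℤ) ^ 2 + 18 * p + 81)) := by
  haveI : NeZero (243 : ℕ) := ⟨by norm_num⟩
  have hp0 : p ≠ 0 := by rintro rfl; simp at hp
  have hf : 9 * p * ℓ ≠ 0 := mul_ne_zero (mul_ne_zero (by norm_num) hp0) hℓ0
  have hle := ringClassField_nine_mul_le hK ι hp0 hℓ0
  have hQ : ((81 * ((p : ℤ) ^ 2 + 4 * p + 16)), (-(9 * (4 * (p : ℤ) ^ 2 + 17 * p + 72))),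
      4 * (p : ℤ) ^ 2 + 18 * p + 81) ∈ heegnerForms 243 (((9 * p : ℕ) : ℤ) ^ 2 * NumberField.discr K) := by
    have h := sylvesterForm_mem_heegnerForms (n := 1) hp one_ne_zero isCoprime_one_left
    simp only [Nat.cast_one, one_pow, one_mul, mul_one] at h
    rw [hdK]; exact h
  have hφ : Dt.IsAutEquivariantOnHeegner (((9 * p : ℕ) : ℤ) ^ 2 * NumberField.discr K) :=
    Dt.isAutEquivariantOnHeegner _
  refine exists_map_subtype_eq_of_forall_ringEquiv W (ringClassField K ι (9 * p * ℓ)) ?_ fun σ hσ ↦ ?_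
  · haveI := (finiteDimensional_and_isGalois_ringClassField hK ι hf).1
    haveI : FiniteDimensional ℚ (ringClassField K ι (9 * p * ℓ)) :=
      Module.Finite.trans K (ringClassField K ι (9 * p * ℓ))
    haveI : Algebra.IsAlgebraic ℚ (ringClassField K ι (9 * p * ℓ)) := Algebra.IsAlgebraic.of_finite ℚ _
    exact Subfield.cardinalMk_le_aleph0_of_isAlgebraic _
  · have hσ' : ∀ x ∈ ringClassField K ι (9 * p), σ x = x := fun x hx ↦ hσ x (hle hx)
    have hσK : ∀ k : K, σ (ι k) = ι k := fun k ↦ hσ' _ (apply_mem_ringClassField ι (9 * p) k)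
    have hsqrt : σ (sqrtDisc (((9 * p : ℕ) : ℤ) ^ 2 * NumberField.discr K)) =
        sqrtDisc (((9 * p : ℕ) : ℤ) ^ 2 * NumberField.discr K) := by
      rw [sqrtDisc_conductor_sq_mul', map_mul, map_natCast, apply_sqrtDisc_discr_eq hK ι hσK]
    exact hφ σ hsqrt hQ hQ (levelTransport_self_sylvesterPoint_one_of_fix hK hdK ι hp hσ')

/-- **THE RECIPE R0 CALLED END-TO-END at the level `9pℓ`** (`M = 1`): for a twist parameter `c ≠ 0` with a
cube root `z ∈ K[9p]` and `b = 9c`, there are `emb : K[9pℓ] → K̄` over `K`, its fixing subgroup `N`, a transport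
`ψ : E₉(K̄) ≃+ E_b(K̄)` scaling by `(v², v³)` with `N v = v`, an admissible `A` with `hdiv`, and
`Q ∈ E₉(K̄)^N` with `ψ Q ∈ invPoints Γ_K A 2` (`Q = Σᵢ ρ(tᵢ)(tᵢ • P)`, `P = κ⁻¹ ι_emb(D_ℓ y_ℓ)`), and the class
`kolyvaginClass (E_b/K) 2 hdiv hA (ψ Q) hQ'` vanishes iff `Q ∈ 2 · E₉(K̄)^N` (Gross 4.7 (1)).
[cite: GrossLMS1991, §3 Prop. 3.6, §4 (4.1)–(4.4), Prop. 4.7 (1)] [cite: HuShuYin2019, §2 Prop. 2.4, §4.1] -/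
theorem exists_recipeShape_sylvester_prime {ω : K} (hω : ω ^ 2 + ω + 1 = 0)
    (h2 : Module.finrank ℚ K = 2) (ι : K →+* ℂ) {W : WeierstrassCurve ℚ}
    (Dt : ModularParametrizationData W 243)
    (κ : geomPoints ((cubeSumCurve 9).baseChange K) ≃+ geomPoints (W.baseChange K))
    (hκ : ∀ (g : Field.absoluteGaloisGroup K) (P : geomPoints ((cubeSumCurve 9).baseChange K)),
      κ (g • P) = g • κ P)
    {p ℓ : ℕ} (hp : p.Prime) (hp3 : p % 3 = 1) (hℓ : ℓ.Prime) (hℓ3 : ℓ % 3 = 2) (hℓ2 : ℓ ≠ 2)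
    (hMa : ((2 ^ 1 : ℕ) : ℤ) ∣ W.LFunction ℓ) {b c : ℚ} (hc : c ≠ 0) (hb : b = 9 * c)
    {z : ringClassField K ι (9 * p)} (hz : (z : ℂ) ^ 3 = (c : ℂ)) :
    ∃ (emb : ringClassField K ι (9 * p * ℓ) →+* AlgebraicClosure K)
      (_ : ∀ k : K, emb (algebraMap K (ringClassField K ι (9 * p * ℓ)) k) =
        algebraMap K (AlgebraicClosure K) k)
      (N : Subgroup (Field.absoluteGaloisGroup K))
      (_ : ∀ g, g ∈ N ↔ ∀ x : ringClassField K ι (9 * p * ℓ),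
        (show AlgebraicClosure K ≃ₐ[K] AlgebraicClosure K from g) (emb x) = emb x)
      (v : AlgebraicClosure K)
      (ψ : geomPoints ((cubeSumCurve 9).baseChange K) ≃+ geomPoints ((cubeSumCurve b).baseChange K))
      (_ : ∀ {x y : AlgebraicClosure K}
        (h : (((cubeSumCurve 9).baseChange K).baseChange (AlgebraicClosure K)).toAffine.Nonsingular x y),
        ∃ h', ψ (Affine.Point.some x y h) = Affine.Point.some (v ^ 2 * x) (v ^ 3 * y) h')
      (_ : ∀ h ∈ N, (show AlgebraicClosure K ≃ₐ[K] AlgebraicClosure K from h) v = v)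
      (A : AddSubgroup (geomPoints ((cubeSumCurve b).baseChange K)))
      (hdiv : ∀ P : geomPoints ((cubeSumCurve b).baseChange K),
        ∃ R : geomPoints ((cubeSumCurve b).baseChange K), ((2 ^ 1 : ℕ) : ℤ) • R = P)
      (hA : KolyvaginCocycle.IsAdmissible (Field.absoluteGaloisGroup K) A ((2 ^ 1 : ℕ) : ℤ))
      (Q : geomPoints ((cubeSumCurve 9).baseChange K))
      (_ : Q ∈ FixedPoints.addSubgroup N (geomPoints ((cubeSumCurve 9).baseChange K)))
      (hQ' : ψ Q ∈ KolyvaginCocycle.invPoints (Field.absoluteGaloisGroup K) A ((2 ^ 1 : ℕ) : ℤ)),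
      (kolyvaginClass ((cubeSumCurve b).baseChange K) ((2 ^ 1 : ℕ) : ℤ) hdiv hA (ψ Q) hQ' = 0 ↔
        ∃ B ∈ FixedPoints.addSubgroup N (geomPoints ((cubeSumCurve 9).baseChange K)),
          ((2 ^ 1 : ℕ) : ℤ) • B = Q) := by
  have hK := JZero.isImaginaryQuadratic_of_sq_add_self_add_one hω h2
  have hdK := JZero.discr_eq_neg_three_of_sq_add_self_add_one hω h2
  have hinert := JZero.span_natCast_isPrime_of_mod_three_eq_two hω h2 hℓ hℓ3
  have hp0 : p ≠ 0 := hp.ne_zero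
  have hℓp : ¬ ℓ ∣ p := fun h ↦ by
    have := (Nat.prime_dvd_prime_iff_eq hℓ hp).mp h
    omega
  have hℓ3' : ℓ ≠ 3 := by rintro rfl; simp at hℓ3
  have hℓ9 : ¬ ℓ ∣ 9 := by
    intro h
    have h' : ℓ ∣ 3 ^ 2 := by norm_num; exact h
    exact hℓ3' ((Nat.prime_dvd_prime_iff_eq hℓ Nat.prime_three).mp (hℓ.dvd_of_dvd_pow h'))
  have hℓ9p : ¬ ℓ ∣ 9 * p := by
    intro h
    rcases (Nat.Prime.dvd_mul hℓ).mp h with h9 | hp'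
    · exact hℓ9 h9
    · exact hℓp hp'
  have hf : 9 * p ≠ 0 := mul_ne_zero (by norm_num) hp0
  have hn0 : 9 * p * ℓ ≠ 0 := mul_ne_zero hf hℓ.ne_zero
  have hMℓ : 2 ^ 1 ∣ ℓ + 1 := by
    rw [pow_one]
    exact (hℓ.eq_two_or_odd'.resolve_left hℓ2).add_one.two_dvd
  have hp_odd : Odd p := hp.eq_two_or_odd'.resolve_left (by rintro rfl; simp at hp3)
  have hℓ_odd : Odd ℓ := hℓ.eq_two_or_odd'.resolve_left hℓ2
  haveI := (finiteDimensional_and_isGalois_ringClassField hK ι hn0).1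
  haveI := (finiteDimensional_and_isGalois_ringClassField hK ι hn0).2
  -- the finite-level data: `y_ℓ`, `y₀`, `σ_ℓ` (all EXIST: #R-a, x11b3/RingClassGalOverCyclic)
  obtain ⟨y, hy⟩ := exists_map_eq_phi_sylvesterTau_of_primeFactors hK hdK ι Dt (n := ℓ) hp3 hℓ.ne_zero
    (fun q hq ↦ by rw [hℓ.primeFactors, Finset.mem_singleton] at hq; rw [hq]; exact hℓ3)
  obtain ⟨y₀, hy₀⟩ := exists_map_eq_phi_sylvesterTau_one_nine_mul hK hdK ι Dt hp3 hℓ.ne_zero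
  obtain ⟨σ, hσ⟩ : ∃ σ : ringClassField K ι (9 * p * ℓ) ≃ₐ[ℚ] ringClassField K ι (9 * p * ℓ),
      Subgroup.zpowers σ = ringClassGalOver ι (9 * p * ℓ) (9 * p) := by
    have h := RingClassGalOverCyclic.exists_zpowers_eq_ringClassGalOver_mul hK ι hf hℓ hℓ9p hinert
    have hlev : ℓ * (9 * p) = 9 * p * ℓ := by ring
    rw [hlev] at h
    exact h
  -- the `K̄`-level package (#R-c)
  obtain ⟨emb, hemb⟩ := exists_emb_ringClassField hK ι hn0
  obtain ⟨N, hN⟩ := exists_subgroup_mem_iff emb hemb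
  haveI : N.Normal := normal_of_mem_iff emb hemb N hN
  obtain ⟨N', hN'⟩ := exists_subgroup_mem_iff_forall emb
    {x : ringClassField K ι (9 * p * ℓ) | (x : ℂ) ∈ ringClassField K ι (9 * p)}
  have hNN' : N ≤ N' := le_of_mem_iff_of_mem_iff_forall emb hN hN'
  have hN'c := forall_apply_eq_of_coe_pow_three_eq_of_fix_nine_mul hω h2 ι hp0 hℓ.ne_zero emb hemb N' hN'
    (c := c) hz
  have h6 := pow_three_ne_six_of_fix_sylvester_prime hK hdK ι hp_odd hℓ_odd emb hemb N hN
  obtain ⟨n, t, ht⟩ := exists_transversal_quotient hK ι hp0 hℓ.ne_zero emb hemb N' hN'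
  -- the point `P = κ⁻¹ ι_emb(D_ℓ y_ℓ)` and its invariance
  let ιe : letI : DecidableEq (ringClassField K ι (9 * p * ℓ)) := fun a b ↦ Classical.propDecidable (a = b)
      (W.baseChange (ringClassField K ι (9 * p * ℓ))).toAffine.Point →+ geomPoints (W.baseChange K) :=
    letI : DecidableEq (ringClassField K ι (9 * p * ℓ)) := fun a b ↦ Classical.propDecidable (a = b)
    Affine.Point.map (W' := W) emb.toRatAlgHom
  have hιe : ∀ P, ιe P = Affine.Point.map (W' := W) emb.toRatAlgHom P := fun _ ↦ rfl
  have hPN := map_emb_mem_fixedPoints W ι emb ιe hιe N hN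
    (KolyvaginOperator.derivOp (pointGalHom W (ringClassField K ι (9 * p * ℓ))) σ ℓ y)
  have hP := exists_fixedPoints_zsmul_eq_smul_map_derivOp_sub hK hdK ι Dt hp3 hℓ hℓ3 hℓp hinert hMℓ hMa
    hσ hy hy₀ emb hemb ιe hιe N hN N' hN'
  obtain ⟨v, ψ, ρ, hdiv, hA', hQ', hvc, -, hψ, -, -, hχA, hc0⟩ :=
    exists_cmFrame_kolyvaginClass K hω b c hc hb N N' hNN' hN'c h6 t ht 1
      (κ.symm (ιe (KolyvaginOperator.derivOp (pointGalHom W (ringClassField K ι (9 * p * ℓ))) σ ℓ y)))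
      (mem_fixedPoints_symm_of_equivariant κ hκ N hPN)
      (fun h hh ↦ exists_fixedPoints_zsmul_eq_symm_of_equivariant κ hκ N (hP h hh))
  exact ⟨emb, hemb, N, hN, v, ψ, hψ, fun h hh ↦ hN'c h (hNN' hh) v hvc, _, hdiv, hA', _, hχA, hQ', hc0⟩


/-! ### The two cubic twists of the rows: `E_p` (`c = p/9`) and `E_{3p²}` (`c = p²/3`) -/

/-- `∛(p/9) = ∛(3p)/3 ∈ K[9p]` as an element `z` with `z³ = p/9` in `ℂ`. [cite: HuShuYin2019, §2 Prop. 2.4 (1), p. 8] -/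
theorem exists_coe_pow_three_eq_div_nine {ω : K} (hω : ω ^ 2 + ω + 1 = 0) (h2 : Module.finrank ℚ K = 2) (ι : K →+* ℂ)
    {p : ℕ} (hp0 : p ≠ 0) :
    ∃ z : ringClassField K ι (9 * p), (z : ℂ) ^ 3 = (((p : ℚ) / 9 : ℚ) : ℂ) := by
  obtain ⟨r, hr⟩ := IsAlgClosed.exists_pow_nat_eq (3 * (p : ℂ)) (by norm_num : 0 < 3)
  have hrmem : r ∈ ringClassField K ι (9 * p) := by
    have h := cubeRoot_three_mul_mem_ringClassField hω h2 ι hp0 one_ne_zero r hr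
    rwa [mul_one] at h
  have h3mem : (3 : ℂ) ∈ ringClassField K ι (9 * p) := by
    have h := apply_mem_ringClassField ι (9 * p) (3 : K)
    rwa [map_ofNat] at h
  refine ⟨⟨r / 3, div_mem hrmem h3mem⟩, ?_⟩
  show (r / 3) ^ 3 = (((p : ℚ) / 9 : ℚ) : ℂ)
  rw [div_pow, hr]; push_cast; ring

/-- `∛(p²/3) = (∛(3p))²/3 ∈ K[9p]` as an element `z` with `z³ = p²/3` in `ℂ`. [cite: HuShuYin2019, §2 Prop. 2.4 (1)] -/
theorem exists_coe_pow_three_eq_sq_div_three {ω : K} (hω : ω ^ 2 + ω + 1 = 0)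
    (h2 : Module.finrank ℚ K = 2) (ι : K →+* ℂ) {p : ℕ} (hp0 : p ≠ 0) :
    ∃ z : ringClassField K ι (9 * p), (z : ℂ) ^ 3 = (((p : ℚ) ^ 2 / 3 : ℚ) : ℂ) := by
  obtain ⟨r, hr⟩ := IsAlgClosed.exists_pow_nat_eq (3 * (p : ℂ)) (by norm_num : 0 < 3)
  have hrmem : r ∈ ringClassField K ι (9 * p) := by
    have h := cubeRoot_three_mul_mem_ringClassField hω h2 ι hp0 one_ne_zero r hr
    rwa [mul_one] at h
  have h3mem : (3 : ℂ) ∈ ringClassField K ι (9 * p) := by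
    have h := apply_mem_ringClassField ι (9 * p) (3 : K)
    rwa [map_ofNat] at h
  refine ⟨⟨r ^ 2 / 3, div_mem (pow_mem hrmem 2) h3mem⟩, ?_⟩
  show (r ^ 2 / 3) ^ 3 = (((p : ℚ) ^ 2 / 3 : ℚ) : ℂ)
  rw [div_pow, ← pow_mul, show 2 * 3 = 3 * 2 from rfl, pow_mul, hr]; push_cast; ring

/-- **Recipe-shape witnesses for the twist `E_b`, `b ∈ {p, 3p²}`** (`c = p/9` resp. `p²/3`; model `W` of `E_9`
with `Dt`, equivariant `κ`, `2 ∣ a_ℓ(W)`). [cite: GrossLMS1991, §4 (4.1)–(4.4), Prop. 4.7 (1)] [cite: HuShuYin2019, §2 p. 8] -/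
theorem exists_recipeShape_cubicTwist {ω : K} (hω : ω ^ 2 + ω + 1 = 0)
    (h2 : Module.finrank ℚ K = 2) (ι : K →+* ℂ) {W : WeierstrassCurve ℚ}
    (Dt : ModularParametrizationData W 243)
    (κ : geomPoints ((cubeSumCurve 9).baseChange K) ≃+ geomPoints (W.baseChange K))
    (hκ : ∀ (g : Field.absoluteGaloisGroup K) (P : geomPoints ((cubeSumCurve 9).baseChange K)),
      κ (g • P) = g • κ P)
    {p ℓ : ℕ} (hp : p.Prime) (hp3 : p % 3 = 1) (hℓ : ℓ.Prime) (hℓ3 : ℓ % 3 = 2) (hℓ2 : ℓ ≠ 2)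
    (hMa : ((2 ^ 1 : ℕ) : ℤ) ∣ W.LFunction ℓ) {b : ℚ} (hb : b = p ∨ b = 3 * (p : ℚ) ^ 2) :
    ∃ (emb : ringClassField K ι (9 * p * ℓ) →+* AlgebraicClosure K)
      (_ : ∀ k : K, emb (algebraMap K (ringClassField K ι (9 * p * ℓ)) k) =
        algebraMap K (AlgebraicClosure K) k)
      (N : Subgroup (Field.absoluteGaloisGroup K))
      (_ : ∀ g, g ∈ N ↔ ∀ x : ringClassField K ι (9 * p * ℓ),
        (show AlgebraicClosure K ≃ₐ[K] AlgebraicClosure K from g) (emb x) = emb x)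
      (v : AlgebraicClosure K)
      (ψ : geomPoints ((cubeSumCurve 9).baseChange K) ≃+ geomPoints ((cubeSumCurve b).baseChange K))
      (_ : ∀ {x y : AlgebraicClosure K}
        (h : (((cubeSumCurve 9).baseChange K).baseChange (AlgebraicClosure K)).toAffine.Nonsingular x y),
        ∃ h', ψ (Affine.Point.some x y h) = Affine.Point.some (v ^ 2 * x) (v ^ 3 * y) h')
      (_ : ∀ h ∈ N, (show AlgebraicClosure K ≃ₐ[K] AlgebraicClosure K from h) v = v)
      (A : AddSubgroup (geomPoints ((cubeSumCurve b).baseChange K)))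
      (hdiv : ∀ P : geomPoints ((cubeSumCurve b).baseChange K),
        ∃ R : geomPoints ((cubeSumCurve b).baseChange K), ((2 ^ 1 : ℕ) : ℤ) • R = P)
      (hA : KolyvaginCocycle.IsAdmissible (Field.absoluteGaloisGroup K) A ((2 ^ 1 : ℕ) : ℤ))
      (Q : geomPoints ((cubeSumCurve 9).baseChange K))
      (_ : Q ∈ FixedPoints.addSubgroup N (geomPoints ((cubeSumCurve 9).baseChange K)))
      (hQ' : ψ Q ∈ KolyvaginCocycle.invPoints (Field.absoluteGaloisGroup K) A ((2 ^ 1 : ℕ) : ℤ)),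
      (kolyvaginClass ((cubeSumCurve b).baseChange K) ((2 ^ 1 : ℕ) : ℤ) hdiv hA (ψ Q) hQ' = 0 ↔
        ∃ B ∈ FixedPoints.addSubgroup N (geomPoints ((cubeSumCurve 9).baseChange K)),
          ((2 ^ 1 : ℕ) : ℤ) • B = Q) := by
  have hp0 : (p : ℚ) ≠ 0 := by exact_mod_cast hp.ne_zero
  rcases hb with rfl | rfl
  · obtain ⟨z, hz⟩ := exists_coe_pow_three_eq_div_nine hω h2 ι hp.ne_zero
    exact exists_recipeShape_sylvester_prime hω h2 ι Dt κ hκ hp hp3 hℓ hℓ3 hℓ2 hMa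
      (c := (p : ℚ) / 9) (by positivity) (by ring) hz
  · obtain ⟨z, hz⟩ := exists_coe_pow_three_eq_sq_div_three hω h2 ι hp.ne_zero
    exact exists_recipeShape_sylvester_prime hω h2 ι Dt κ hκ hp hp3 hℓ hℓ3 hℓ2 hMa
      (c := (p : ℚ) ^ 2 / 3) (by positivity) (by ring) hz

/-- **`κ` and `2 ∣ a_ℓ` DISCHARGED for E₉'s minimal model `W₀ = (y² + y = x³ − 1)`** (k-ty1 #16; `a_ℓ(W₀) = 0`
for `ℓ ≡ 2 (3)`, `ℓ ≠ 2`): given ONLY `Dt : ModularParametrizationData W₀ 243`, the route binders and the primes,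
the recipe-shape witnesses exist for `E_p` and `E_{3p²}`. [cite: GrossLMS1991, §3 (3.3), §4] [cite: HuShuYin2019, §1 p. 4, §4.1] -/
theorem exists_recipeShape_cubicTwist_sylvesterNineMinimal {ω : K} (hω : ω ^ 2 + ω + 1 = 0)
    (h2 : Module.finrank ℚ K = 2) (ι : K →+* ℂ)
    (Dt : ModularParametrizationData (⟨0, 0, 1, 0, -1⟩ : WeierstrassCurve ℚ) 243)
    {p ℓ : ℕ} (hp : p.Prime) (hp3 : p % 3 = 1) (hℓ : ℓ.Prime) (hℓ3 : ℓ % 3 = 2) (hℓ2 : ℓ ≠ 2)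
    {b : ℚ} (hb : b = p ∨ b = 3 * (p : ℚ) ^ 2) :
    ∃ (κ : geomPoints ((cubeSumCurve 9).baseChange K) ≃+
        geomPoints ((⟨0, 0, 1, 0, -1⟩ : WeierstrassCurve ℚ).baseChange K))
      (_ : ∀ (g : Field.absoluteGaloisGroup K) (P : geomPoints ((cubeSumCurve 9).baseChange K)),
        κ (g • P) = g • κ P)
      (emb : ringClassField K ι (9 * p * ℓ) →+* AlgebraicClosure K)
      (_ : ∀ k : K, emb (algebraMap K (ringClassField K ι (9 * p * ℓ)) k) =
        algebraMap K (AlgebraicClosure K) k)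
      (N : Subgroup (Field.absoluteGaloisGroup K))
      (_ : ∀ g, g ∈ N ↔ ∀ x : ringClassField K ι (9 * p * ℓ),
        (show AlgebraicClosure K ≃ₐ[K] AlgebraicClosure K from g) (emb x) = emb x)
      (v : AlgebraicClosure K)
      (ψ : geomPoints ((cubeSumCurve 9).baseChange K) ≃+ geomPoints ((cubeSumCurve b).baseChange K))
      (_ : ∀ {x y : AlgebraicClosure K}
        (h : (((cubeSumCurve 9).baseChange K).baseChange (AlgebraicClosure K)).toAffine.Nonsingular x y),
        ∃ h', ψ (Affine.Point.some x y h) = Affine.Point.some (v ^ 2 * x) (v ^ 3 * y) h')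
      (_ : ∀ h ∈ N, (show AlgebraicClosure K ≃ₐ[K] AlgebraicClosure K from h) v = v)
      (A : AddSubgroup (geomPoints ((cubeSumCurve b).baseChange K)))
      (hdiv : ∀ P : geomPoints ((cubeSumCurve b).baseChange K),
        ∃ R : geomPoints ((cubeSumCurve b).baseChange K), ((2 ^ 1 : ℕ) : ℤ) • R = P)
      (hA : KolyvaginCocycle.IsAdmissible (Field.absoluteGaloisGroup K) A ((2 ^ 1 : ℕ) : ℤ))
      (Q : geomPoints ((cubeSumCurve 9).baseChange K))
      (_ : Q ∈ FixedPoints.addSubgroup N (geomPoints ((cubeSumCurve 9).baseChange K)))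
      (hQ' : ψ Q ∈ KolyvaginCocycle.invPoints (Field.absoluteGaloisGroup K) A ((2 ^ 1 : ℕ) : ℤ)),
      (kolyvaginClass ((cubeSumCurve b).baseChange K) ((2 ^ 1 : ℕ) : ℤ) hdiv hA (ψ Q) hQ' = 0 ↔
        ∃ B ∈ FixedPoints.addSubgroup N (geomPoints ((cubeSumCurve 9).baseChange K)),
          ((2 ^ 1 : ℕ) : ℤ) • B = Q) := by
  haveI := isElliptic_sylvesterNineMinimal
  haveI := isGloballyMinimal_sylvesterNineMinimal
  have hℓ3' : ℓ ≠ 3 := by rintro rfl; simp at hℓ3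
  have hMa : ((2 ^ 1 : ℕ) : ℤ) ∣ (⟨0, 0, 1, 0, -1⟩ : WeierstrassCurve ℚ).LFunction ℓ := by
    rw [JZero.lFunction_eq_zero_of_j_eq_zero_of_mod_three_eq_two _ j_sylvesterNineMinimal hℓ hℓ3 hℓ2
      (not_dvd_minimalDiscriminantInt_sylvesterNineMinimal hℓ hℓ3')]
    exact dvd_zero _
  obtain ⟨κ, hκ, -⟩ := exists_frameTransport_cubeSumCurve_nine K
  obtain ⟨emb, hemb, N, hN, v, ψ, hψ, hNv, A, hdiv, hA, Q, hQN, hQ', hc0⟩ :=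
    exists_recipeShape_cubicTwist hω h2 ι Dt κ hκ hp hp3 hℓ hℓ3 hℓ2 hMa hb
  exact ⟨κ, hκ, emb, hemb, N, hN, v, ψ, hψ, hNv, A, hdiv, hA, Q, hQN, hQ', hc0⟩


/-! ### #24's per-`ℓ` ∃-block VERBATIM (FLIP conjunct omitted), `(2 : ℕ)` literals -/

/-- **#24's FIRST per-`ℓ` ∃-block (the class `c_A(ℓ)` on `E_{3p²}` in recipe shape), VERBATIM minus the
FLIP iff** — for the rows to plug with zero glue (planner D453 (i)): from the route binders, any model `W` of
`E_9` with `Dt`, an equivariant frame transport `κ` and `2 ∣ a_ℓ(W)`, at a prime `p ≡ 1 (3)` and a Kolyvagin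
prime `ℓ ≡ 2 (3)`, `ℓ ≠ 2`: `∃ c ιK emb _ N _ v ψ _ _ A hdiv hA Q _ hQ', c = kolyvaginClass (E_{3p²}/K) 2 hdiv hA (ψ Q) hQ'`.
[cite: GrossLMS1991, §4 (4.1)–(4.4)] [cite: HuShuYin2019, §2 p. 8, §4.1] -/
theorem exists_recipeBlock_three_mul_sq {ω : K} (hω : ω ^ 2 + ω + 1 = 0)
    (h2 : Module.finrank ℚ K = 2) (ι : K →+* ℂ) {W : WeierstrassCurve ℚ}
    (Dt : ModularParametrizationData W 243)
    (κ : geomPoints ((cubeSumCurve 9).baseChange K) ≃+ geomPoints (W.baseChange K))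
    (hκ : ∀ (g : Field.absoluteGaloisGroup K) (P : geomPoints ((cubeSumCurve 9).baseChange K)),
      κ (g • P) = g • κ P)
    {p ℓ : ℕ} (hp : p.Prime) (hp3 : p % 3 = 1) (hℓ : ℓ.Prime) (hℓ3 : ℓ % 3 = 2) (hℓ2 : ℓ ≠ 2)
    (hMa : ((2 ^ 1 : ℕ) : ℤ) ∣ W.LFunction ℓ) :
    ∃ (c : galH1Torsion ((cubeSumCurve (3 * (p : ℚ) ^ 2)).baseChange K) (2 : ℕ))
      (ιK : K →+* ℂ) (emb : ringClassField K ιK (9 * p * ℓ) →+* AlgebraicClosure K)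
      (_ : ∀ k : K, emb (algebraMap K (ringClassField K ιK (9 * p * ℓ)) k) =
        algebraMap K (AlgebraicClosure K) k)
      (N : Subgroup (Field.absoluteGaloisGroup K))
      (_ : ∀ g, g ∈ N ↔ ∀ x : ringClassField K ιK (9 * p * ℓ),
        (show AlgebraicClosure K ≃ₐ[K] AlgebraicClosure K from g) (emb x) = emb x)
      (v : AlgebraicClosure K)
      (ψ : geomPoints ((cubeSumCurve 9).baseChange K) ≃+
        geomPoints ((cubeSumCurve (3 * (p : ℚ) ^ 2)).baseChange K))
      (_ : ∀ {x y : AlgebraicClosure K}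
        (h : (((cubeSumCurve 9).baseChange K).baseChange (AlgebraicClosure K)).toAffine.Nonsingular x y),
        ∃ h', ψ (Affine.Point.some x y h) = Affine.Point.some (v ^ 2 * x) (v ^ 3 * y) h')
      (_ : ∀ h ∈ N, (show AlgebraicClosure K ≃ₐ[K] AlgebraicClosure K from h) v = v)
      (A : AddSubgroup (geomPoints ((cubeSumCurve (3 * (p : ℚ) ^ 2)).baseChange K)))
      (hdiv : ∀ P : geomPoints ((cubeSumCurve (3 * (p : ℚ) ^ 2)).baseChange K),
        ∃ R : geomPoints ((cubeSumCurve (3 * (p : ℚ) ^ 2)).baseChange K), ((2 : ℕ) : ℤ) • R = P)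
      (hA : KolyvaginCocycle.IsAdmissible (Field.absoluteGaloisGroup K) A ((2 : ℕ) : ℤ))
      (Q : geomPoints ((cubeSumCurve 9).baseChange K))
      (_ : Q ∈ FixedPoints.addSubgroup N (geomPoints ((cubeSumCurve 9).baseChange K)))
      (hQ' : ψ Q ∈ KolyvaginCocycle.invPoints (Field.absoluteGaloisGroup K) A ((2 : ℕ) : ℤ)),
      c = kolyvaginClass ((cubeSumCurve (3 * (p : ℚ) ^ 2)).baseChange K) ((2 : ℕ) : ℤ) hdiv hA (ψ Q) hQ' := by
  obtain ⟨emb, hemb, N, hN, v, ψ, hψ, hNv, A, hdiv, hA, Q, hQN, hQ', -⟩ :=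
    exists_recipeShape_cubicTwist hω h2 ι Dt κ hκ hp hp3 hℓ hℓ3 hℓ2 hMa (b := 3 * (p : ℚ) ^ 2) (Or.inr rfl)
  exact ⟨_, ι, emb, hemb, N, hN, v, ψ, hψ, hNv, A, hdiv, hA, Q, hQN, hQ', rfl⟩

/-- **#24's per-`ℓ` block for the twist `E_p` at the single-prime level** (same shape, `b = p`; the
two-prime block of `c_B(ℓℓ')` is the sibling `…CMDataPairRecipe`). [cite: GrossLMS1991, §4 (4.1)–(4.4)] -/
theorem exists_recipeBlock_prime {ω : K} (hω : ω ^ 2 + ω + 1 = 0)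
    (h2 : Module.finrank ℚ K = 2) (ι : K →+* ℂ) {W : WeierstrassCurve ℚ}
    (Dt : ModularParametrizationData W 243)
    (κ : geomPoints ((cubeSumCurve 9).baseChange K) ≃+ geomPoints (W.baseChange K))
    (hκ : ∀ (g : Field.absoluteGaloisGroup K) (P : geomPoints ((cubeSumCurve 9).baseChange K)),
      κ (g • P) = g • κ P)
    {p ℓ : ℕ} (hp : p.Prime) (hp3 : p % 3 = 1) (hℓ : ℓ.Prime) (hℓ3 : ℓ % 3 = 2) (hℓ2 : ℓ ≠ 2)
    (hMa : ((2 ^ 1 : ℕ) : ℤ) ∣ W.LFunction ℓ) :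
    ∃ (c : galH1Torsion ((cubeSumCurve (p : ℚ)).baseChange K) (2 : ℕ))
      (ιK : K →+* ℂ) (emb : ringClassField K ιK (9 * p * ℓ) →+* AlgebraicClosure K)
      (_ : ∀ k : K, emb (algebraMap K (ringClassField K ιK (9 * p * ℓ)) k) =
        algebraMap K (AlgebraicClosure K) k)
      (N : Subgroup (Field.absoluteGaloisGroup K))
      (_ : ∀ g, g ∈ N ↔ ∀ x : ringClassField K ιK (9 * p * ℓ),
        (show AlgebraicClosure K ≃ₐ[K] AlgebraicClosure K from g) (emb x) = emb x)
      (v : AlgebraicClosure K)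
      (ψ : geomPoints ((cubeSumCurve 9).baseChange K) ≃+ geomPoints ((cubeSumCurve (p : ℚ)).baseChange K))
      (_ : ∀ {x y : AlgebraicClosure K}
        (h : (((cubeSumCurve 9).baseChange K).baseChange (AlgebraicClosure K)).toAffine.Nonsingular x y),
        ∃ h', ψ (Affine.Point.some x y h) = Affine.Point.some (v ^ 2 * x) (v ^ 3 * y) h')
      (_ : ∀ h ∈ N, (show AlgebraicClosure K ≃ₐ[K] AlgebraicClosure K from h) v = v)
      (A : AddSubgroup (geomPoints ((cubeSumCurve (p : ℚ)).baseChange K)))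
      (hdiv : ∀ P : geomPoints ((cubeSumCurve (p : ℚ)).baseChange K),
        ∃ R : geomPoints ((cubeSumCurve (p : ℚ)).baseChange K), ((2 : ℕ) : ℤ) • R = P)
      (hA : KolyvaginCocycle.IsAdmissible (Field.absoluteGaloisGroup K) A ((2 : ℕ) : ℤ))
      (Q : geomPoints ((cubeSumCurve 9).baseChange K))
      (_ : Q ∈ FixedPoints.addSubgroup N (geomPoints ((cubeSumCurve 9).baseChange K)))
      (hQ' : ψ Q ∈ KolyvaginCocycle.invPoints (Field.absoluteGaloisGroup K) A ((2 : ℕ) : ℤ)),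
      c = kolyvaginClass ((cubeSumCurve (p : ℚ)).baseChange K) ((2 : ℕ) : ℤ) hdiv hA (ψ Q) hQ' := by
  obtain ⟨emb, hemb, N, hN, v, ψ, hψ, hNv, A, hdiv, hA, Q, hQN, hQ', -⟩ :=
    exists_recipeShape_cubicTwist hω h2 ι Dt κ hκ hp hp3 hℓ hℓ3 hℓ2 hMa (b := (p : ℚ)) (Or.inl rfl)
  exact ⟨_, ι, emb, hemb, N, hN, v, ψ, hψ, hNv, A, hdiv, hA, Q, hQN, hQ', rfl⟩

end Summit.BirchSwinnertonDyer.BirchSwinnertonDyer.Theorems.SylvesterTwoCMData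

end
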